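import Summits.Ventures.LatticeQCDFlow.TrivializingMaps.FisherZerosExist
import Summits.Ventures.LatticeQCDFlow.TrivializingMaps.FisherRadiusCap

/-!
HONEST FRAMING: exact (Metropolis-corrected) sampling algorithms for lattice gauge theory; figures
of merit are autocorrelation/cost numbers at stated couplings and volumes; no continuum-physics
claim.

# FisherZeroRadiusBound — a zero of the partition function within an EXPLICIT distance of the
# origin, from the mean-square fluctuation of the action (lean-2 GEN-6, ours)

Venture-side (OURS).  Cell `lqcd-flow` (pub-lqcd), unit `pub-lqcd-lean-2-g6`, 2026-08-22.
Quantitative form of `FisherZerosExist`: the Borel–Carathéodory/Schwarz argument used there only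
needs zero-freeness on ONE disc, and then yields an inequality.

* **`variance_le_of_zeroFree_ball`** — if `|X| ≤ b` a.e. under a probability measure and the complex MGF
  `Z(z) = ∫ e^{zX} dμ` has no zero on the open disc `|z| < R` (`R > 0`), then
  `Var X ≤ 128(|b|R + 1)/R²`.
* **`exists_zero_norm_lt_of_variance_gt`** — contrapositive: `Var X > 128(|b|R + 1)/R²` forces a zero
  with `|z| < R`.  So the nearest zero is at distance `≤ R` as soon as `R ≥ 512(|b|+1)/Var X` and
  `R ≥ 1` (`exists_zero_norm_lt_of_le`): an explicit radius in terms of the sup and the variance of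
  the observable only.
* Docked (`Z(s) = ∫ D[U] e^{-sS}`, `S` smooth on the ambient link space):
  `exists_actionZ_eq_zero_norm_lt` — a Fisher zero with `|s₀| < R` whenever
  `Var_{D[U]}(S∘ι) > 128(bR+1)/R²`, `|S∘ι| ≤ b`; and with COROLLARY F′ (`FisherRadiusCap`):
  **`wilson_theoremA_radius_le_of_variance_gt`** — every radius `ρ` of a THEOREM-A-type volume-uniform
  geometric gradient bound for the Wilson action obeys `ρ ≤ R` as soon as ONE volume `L` has
  `Var_{D[U]}(S_W∘ι) > 128(b_L R + 1)/R²` (`|S_W∘ι| ≤ b_L`).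

Reading (not a claim about values): with `b_L ≤ 2n·#plaquettes` (tree `abs_wilsonAction_le`) the
bound becomes VOLUME-UNIFORM exactly when `Var_{D[U]}(S_W)` grows linearly with the number of
plaquettes — the β = 0 specific heat; that input (pairwise uncorrelated plaquettes under product Haar,
`E(Re tr U)² = 1` resp. `½`) is NOT proved here and is recorded as the next item.

NOT CLAIMED: any numerical radius for any `L`, `n`, `β`; volume-uniformity; the number of zeros;
cost / autocorrelation / continuum statements.
-/

open MeasureTheory ProbabilityTheory Filter Topology Complex Set Metric
open Literature.MathematicalPhysics.QuantumFieldTheory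
open Literature.MathematicalPhysics.QuantumFieldTheory.Luscher2010
open Literature.MathematicalPhysics.QuantumFieldTheory.WilsonFlow (coeConfig continuous_coeConfig)
open Literature.NumberTheory.LFunctions.InvZetaRH (exists_log_of_ball)
open scoped Matrix Matrix.Norms.Frobenius ContDiff

namespace Summit.Ventures.LatticeQCDFlow.TrivializingMaps

/-! ## §1 The quantitative zero-free ⟹ small-variance inequality -/

section General

variable {Ω : Type*} [MeasurableSpace Ω] {μ : Measure Ω} [IsProbabilityMeasure μ]
  {X : Ω → ℝ} {b : ℝ}

/-- **Zero-free disc ⟹ small variance.**  If `|X| ≤ b` a.e. under a probability measure and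
`z ↦ ∫ e^{zX} dμ` has no zero on `|z| < R` (`R > 0`), then `Var X ≤ 128(|b|R + 1)/R²`.
(Holomorphic logarithm on the disc, Borel–Carathéodory, two Schwarz–Cauchy estimates,
`(Z′/Z)′(0) = Var X`.) [ours] -/
theorem variance_le_of_zeroFree_ball (hm : AEMeasurable X μ) (hb : ∀ᵐ u ∂μ, |X u| ≤ b)
    {R : ℝ} (hR : 0 < R) (hfree : ∀ z ∈ ball (0 : ℂ) R, complexMGF X μ z ≠ 0) :
    variance X μ ≤ 128 * (|b| * R + 1) / R ^ 2 := by
  set Z := complexMGF X μ with hZdef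
  set G : ℂ → ℂ := fun w => deriv Z w / Z w with hGdef
  have hZd : Differentiable ℂ Z := ZeroPinching.differentiable_complexMGF_of_abs_le hm hb
  have hZ'd : Differentiable ℂ (deriv Z) := by
    have h := (hZd.differentiableOn (s := univ)).deriv isOpen_univ
    exact differentiableOn_univ.mp h
  have hGd : DifferentiableOn ℂ G (ball (0 : ℂ) R) := fun w hw =>
    (((hZ'd w).div (hZd w) (hfree w hw))).differentiableWithinAt
  have hZ0 : Z 0 = 1 := by
    rw [hZdef, show (0 : ℂ) = ((0 : ℝ) : ℂ) from Complex.ofReal_zero.symm, complexMGF_ofReal,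
      mgf_zero]
    simp
  set B : ℝ := |b| with hBdef
  have hB0 : 0 ≤ B := abs_nonneg b
  have hgrowth : ∀ z : ℂ, ‖Z z‖ ≤ Real.exp (B * ‖z‖) := fun z => by
    refine (norm_complexMGF_le_mgf).trans
      ((ZeroPinching.mgf_le_exp_of_abs_le hm hb z.re).trans ?_)
    refine Real.exp_le_exp.mpr ?_
    calc |z.re| * b ≤ |z.re| * B := mul_le_mul_of_nonneg_left (le_abs_self b) (abs_nonneg _)
      _ ≤ ‖z‖ * B := mul_le_mul_of_nonneg_right (abs_re_le_norm z) hB0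
      _ = B * ‖z‖ := mul_comm _ _
  -- holomorphic logarithm on the zero-free disc
  obtain ⟨L, hLd, hL0, hLder, hLexp⟩ :=
    exists_log_of_ball (c := (0 : ℂ)) hR hZd.differentiableOn hfree
  have hL00 : L 0 = 0 := by rw [hL0, hZ0, Complex.log_one]
  set M : ℝ := B * R + 1 with hMdef
  have hM : 0 < M := by positivity
  have hre : MapsTo L (ball 0 R) {w : ℂ | w.re ≤ M} := by
    intro z hz
    have hzR : ‖z‖ < R := mem_ball_zero_iff.mp hz
    have h1 : Real.exp (L z).re = ‖Z z‖ := by rw [← hLexp z hz, Complex.norm_exp]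
    have h2 : Real.exp (L z).re ≤ Real.exp (B * R) := by
      rw [h1]
      exact (hgrowth z).trans (Real.exp_le_exp.mpr (mul_le_mul_of_nonneg_left hzR.le hB0))
    have h3 : (L z).re ≤ B * R := Real.exp_le_exp.mp h2
    show (L z).re ≤ M
    linarith
  -- Borel–Carathéodory on `‖z‖ < R/2`
  have hBC : ∀ z ∈ ball (0 : ℂ) (R / 2), ‖L z‖ ≤ 2 * M := by
    intro z hz
    have hz2 : ‖z‖ < R / 2 := mem_ball_zero_iff.mp hz
    have hzR : z ∈ ball (0 : ℂ) R := mem_ball_zero_iff.mpr (by linarith)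
    have h := Complex.borelCaratheodory_zero hM hLd hre hR hzR hL00
    have hden : 0 < R - ‖z‖ := by linarith
    calc ‖L z‖ ≤ 2 * M * ‖z‖ / (R - ‖z‖) := h
      _ ≤ 2 * M := by
          rw [div_le_iff₀ hden]
          nlinarith [norm_nonneg z]
  -- first Cauchy estimate on `‖w‖ < R/4`
  have hG1 : ∀ w ∈ ball (0 : ℂ) (R / 4), ‖G w‖ ≤ 2 * (2 * M) / (R / 4) := by
    intro w hw
    have hw4 : ‖w‖ < R / 4 := mem_ball_zero_iff.mp hw
    have hsub : ball w (R / 4) ⊆ ball (0 : ℂ) (R / 2) := fun z hz => by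
      rw [mem_ball_zero_iff]
      have : ‖z - w‖ < R / 4 := mem_ball_iff_norm.mp hz
      calc ‖z‖ = ‖(z - w) + w‖ := by rw [sub_add_cancel]
        _ ≤ ‖z - w‖ + ‖w‖ := norm_add_le _ _
        _ < R / 2 := by linarith
    have hsubR : ball w (R / 4) ⊆ ball (0 : ℂ) R :=
      hsub.trans (ball_subset_ball (by linarith))
    have hderw : deriv L w = G w :=
      (hLder w (hsubR (mem_ball_self (by positivity)))).deriv
    rw [← hderw]
    exact norm_deriv_le_two_mul_div_of_norm_le (by positivity) (hLd.mono hsubR)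
      fun z hz => hBC z (hsub hz)
  -- second Cauchy estimate at `0`
  have hG2 : ‖deriv G 0‖ ≤ 2 * (2 * (2 * M) / (R / 4)) / (R / 4) :=
    norm_deriv_le_two_mul_div_of_norm_le (by positivity)
      (hGd.mono (ball_subset_ball (by linarith))) hG1
  have hkey : ‖deriv G 0‖ ≤ 128 * (B * R + 1) / R ^ 2 :=
    calc ‖deriv G 0‖ ≤ 2 * (2 * (2 * M) / (R / 4)) / (R / 4) := hG2
      _ = 128 * (B * R + 1) / R ^ 2 := by rw [hMdef]; field_simp; ring
  have hG0 : deriv G 0 = ((variance X μ : ℝ) : ℂ) := deriv_logDeriv_complexMGF_zero hm hb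
  rw [hG0, Complex.norm_real, Real.norm_eq_abs, abs_of_nonneg (variance_nonneg X μ)] at hkey
  exact hkey

/-- **A zero within radius `R` from the variance.**  If `Var X > 128(|b|R + 1)/R²` then the
complex MGF of `X` vanishes at some `|z| < R`. [ours] -/
theorem exists_zero_norm_lt_of_variance_gt (hm : AEMeasurable X μ) (hb : ∀ᵐ u ∂μ, |X u| ≤ b)
    {R : ℝ} (hR : 0 < R) (hvar : 128 * (|b| * R + 1) / R ^ 2 < variance X μ) :
    ∃ z : ℂ, ‖z‖ < R ∧ complexMGF X μ z = 0 := by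
  by_contra hcon
  have hfree : ∀ z ∈ ball (0 : ℂ) R, complexMGF X μ z ≠ 0 := fun z hz h0 =>
    hcon ⟨z, mem_ball_zero_iff.mp hz, h0⟩
  exact absurd (variance_le_of_zeroFree_ball hm hb hR hfree) (not_le.mpr hvar)

/-- **Explicit radius.**  With `v = Var X > 0`, every `R ≥ 1` with `R ≥ 512(|b| + 1)/v` contains a
zero of the complex MGF in the open disc `|z| < R`. [ours] -/
theorem exists_zero_norm_lt_of_le (hm : AEMeasurable X μ) (hb : ∀ᵐ u ∂μ, |X u| ≤ b)
    (hvar : 0 < variance X μ) {R : ℝ} (hR1 : 1 ≤ R)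
    (hRv : 512 * (|b| + 1) / variance X μ ≤ R) :
    ∃ z : ℂ, ‖z‖ < R ∧ complexMGF X μ z = 0 := by
  have hR0 : 0 < R := by linarith
  refine exists_zero_norm_lt_of_variance_gt hm hb hR0 ?_
  have hB0 : 0 ≤ |b| := abs_nonneg b
  have h1 : 128 * (|b| * R + 1) / R ^ 2 ≤ 128 * (|b| + 1) / R := by
    rw [div_le_div_iff₀ (by positivity) hR0]
    have : |b| * R + 1 ≤ (|b| + 1) * R := by nlinarith
    nlinarith
  have h2 : 128 * (|b| + 1) / R ≤ variance X μ / 4 := by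
    rw [div_le_iff₀ hR0]
    have h3 : 512 * (|b| + 1) ≤ R * variance X μ := by rwa [div_le_iff₀ hvar] at hRv
    nlinarith
  linarith

end General

/-! ## §2 Docked: a Fisher zero of `Z(s) = ∫ D[U] e^{-sS}` within an explicit radius -/

section ActionZ

variable {d L n : ℕ} [NeZero L] {S : AmbConfig d L n → ℝ}

/-- **A Fisher zero within radius `R` from the β = 0 fluctuation of the action**: for a smooth
action with `|S∘ι| ≤ b` and `Var_{D[U]}(S∘ι) > 128(|b|R + 1)/R²` (`R > 0`), the partition function
has a zero `s₀` with `|s₀| < R`. [ours] -/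
theorem exists_actionZ_eq_zero_norm_lt (hS : ContDiff ℝ ∞ S) {b : ℝ}
    (hb : ∀ U : GaugeConfig d L (Matrix.specialUnitaryGroup (Fin n) ℂ), |S (coeConfig U)| ≤ b)
    {R : ℝ} (hR : 0 < R)
    (hvar : 128 * (|b| * R + 1) / R ^ 2 < variance (fun U => S (coeConfig U))
      (trivialMeasure (Matrix.specialUnitaryGroup (Fin n) ℂ) d L)) :
    ∃ s₀ : ℂ, ‖s₀‖ < R ∧ complexMGF (fun U => -S (coeConfig U))
      (trivialMeasure (Matrix.specialUnitaryGroup (Fin n) ℂ) d L) s₀ = 0 := by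
  have hm : AEMeasurable (fun U => -S (coeConfig U))
      (trivialMeasure (Matrix.specialUnitaryGroup (Fin n) ℂ) d L) :=
    (integrable_trivialMeasure_of_continuous (continuous_comp_coeConfig hS).neg).aemeasurable
  refine exists_zero_norm_lt_of_variance_gt (b := b) hm (ae_of_all _ fun U => by simpa using hb U)
    hR ?_
  rw [variance_fun_neg]
  exact hvar

/-- **COROLLARY (F′ + the radius bound): THEOREM A's radius is capped by the β = 0 variance of the
Wilson action in any ONE volume.**  If `(ρ, C)` satisfies the volume-uniform geometric gradient bound of
`LuscherGeometricGradientBound d n` (as in `wilson_radius_le_norm_of_actionZ_eq_zero`), and some volume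
`L` has `|S_W∘ι| ≤ b` and `Var_{D[U]}(S_W∘ι) > 128(|b|R + 1)/R²` (`R > 0`), then `ρ ≤ R`. [ours] -/
theorem wilson_theoremA_radius_le_of_variance_gt {ρ C : ℝ} (hρ : 0 < ρ)
    (hA : ∀ (L : ℕ) [NeZero L] (B : SuBasis n) (Sk : ℕ → AmbConfig d L n → ℝ) (c : ℕ → ℝ),
      (∀ k, ContDiff ℝ ∞ (Sk k)) → IsLuscherSeries B ambWilsonAction Sk c →
      ∀ (k : ℕ) (U : GaugeConfig d L (Matrix.specialUnitaryGroup (Fin n) ℂ)) (e : Edge d L)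
        (a : B.ι), |linkDeriv e (B.T a) (Sk k) (coeConfig U)| ≤ C * ρ⁻¹ ^ k)
    (B : SuBasis n) (L : ℕ) [NeZero L] {b : ℝ}
    (hb : ∀ U : GaugeConfig d L (Matrix.specialUnitaryGroup (Fin n) ℂ),
      |ambWilsonAction (coeConfig U)| ≤ b)
    {R : ℝ} (hR : 0 < R)
    (hvar : 128 * (|b| * R + 1) / R ^ 2 < variance (fun U => ambWilsonAction (coeConfig U))
      (trivialMeasure (Matrix.specialUnitaryGroup (Fin n) ℂ) d L)) :
    ρ ≤ R := by
  obtain ⟨s₀, hs₀, hz⟩ := exists_actionZ_eq_zero_norm_lt (d := d) (L := L) (n := n)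
    contDiff_ambWilsonAction hb hR hvar
  exact (wilson_radius_le_norm_of_actionZ_eq_zero hρ hA B L hz).trans hs₀.le

end ActionZ

end Summit.Ventures.LatticeQCDFlow.TrivializingMaps
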